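import Summits.HubbardSuperconductivity.HubbardSuperconductivity.Theorems.DeformationLadderLowEnergyRigidityTelescopeRigidityFourier

/-!
# Telescope rigidity, part 8: the cells of the telescope are products of arithmetic progressions

Route `DeformationLadder`, crux `LowEnergyRigidity` (item stmt-HubbardSuperconductivity-1892), line
`Sketch` (poincare-telescope). Support file (no definitions) for the converse of part 6.

The one-dimensional cells ("rows") `R_j = {x ∈ ℤ/L : ⌊x.val·k/L⌋ = j}` of the telescope's cell map
`cellIndex` are the progressions `{a_j, a_j + 1, …, a_{j+1} − 1}` with `a_j = ⌈jL/k⌉`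
(`rigc_row_eq_image`), of size `n_j = a_{j+1} − a_j` within `1` of `L/k` (`rigc_row_card_bounds`);
the two-dimensional cell `{x : cellOf L k x = b}` is the product of the rows of `b 0` and `b 1`
(`rigc_cell_eq_piFinset`). Consequences for the character transform
`ĝ_b(q) = Σ_{x ∈ cell b} χ_q(x)` of a cell indicator: the product formula (`rigc_cellTransform_eq_prod`),
`‖ĝ_b(q)‖ ≤ |cell b|`, the row bounds `‖r_j(q)‖ ≤ L/(2‖q‖)` off `q = 0` and the row Parseval identity,
and the TAIL ESTIMATE `Σ_{q : ‖q i₀‖ > K} ‖ĝ_b(q)‖² ≤ L³ (L/k + 1) / (2K)` (`rigc_cellTransform_tail_le`).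
[folklore]
-/

noncomputable section

namespace Summit.HubbardSuperconductivity.HubbardSuperconductivity.Theorems.LowEnergyRigidity.Telescope

set_option linter.dupNamespace false -- summit = problem name (single-conjunct summit), D-0017

open Matrix Literature.MathematicalPhysics.QuantumLattice Literature.Probability.LatticeModels
open scoped ComplexConjugate ComplexOrder

/-! ### Ceiling division and the rows -/

/-- `⌈c/k⌉ ≤ v ↔ c ≤ v·k` for the ceiling division `⌈c/k⌉ = (c + k − 1)/k`. [folklore] -/
theorem rigc_ceilDiv_le_iff {k : ℕ} (hk : 0 < k) (c v : ℕ) : (c + k - 1) / k ≤ v ↔ c ≤ v * k := by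
  rw [← Nat.lt_add_one_iff, Nat.div_lt_iff_lt_mul hk, add_mul, one_mul]
  generalize v * k = w
  omega

/-- `k · ⌈c/k⌉` lies in `[c, c + k − 1]`. [folklore] -/
theorem rigc_mul_ceilDiv_bounds {k : ℕ} (hk : 0 < k) (c : ℕ) :
    c ≤ (c + k - 1) / k * k ∧ (c + k - 1) / k * k ≤ c + k - 1 :=
  ⟨(rigc_ceilDiv_le_iff hk c _).mp le_rfl, Nat.div_mul_le_self _ _⟩

/-- **Row membership**: `⌊x.val·k/L⌋ = j ↔ ⌈jL/k⌉ ≤ x.val < ⌈(j+1)L/k⌉`. [folklore] -/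
theorem rigc_mem_row_iff {L k : ℕ} (hL : 0 < L) (hk : 0 < k) (v j : ℕ) :
    v * k / L = j ↔ (j * L + k - 1) / k ≤ v ∧ v < ((j + 1) * L + k - 1) / k := by
  rw [rigc_ceilDiv_le_iff hk, ← not_le, rigc_ceilDiv_le_iff hk, not_le]
  constructor
  · intro h
    refine ⟨(Nat.le_div_iff_mul_le hL).mp h.ge, ?_⟩
    have h2 : v * k / L < j + 1 := by rw [h]; exact Nat.lt_succ_self j
    exact (Nat.div_lt_iff_lt_mul hL).mp h2
  · rintro ⟨h1, h2⟩
    apply le_antisymm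
    · exact Nat.lt_succ_iff.mp ((Nat.div_lt_iff_lt_mul hL).mpr h2)
    · exact (Nat.le_div_iff_mul_le hL).mpr h1

/-- `⌈(j+1)L/k⌉ ≤ L` for `j < k`. [folklore] -/
theorem rigc_ceil_succ_le {L k j : ℕ} (hk : 0 < k) (hj : j < k) : ((j + 1) * L + k - 1) / k ≤ L := by
  rw [Nat.div_le_iff_le_mul_add_pred hk]
  have h : (j + 1) * L ≤ k * L := Nat.mul_le_mul_right L hj
  generalize (j + 1) * L = A at *
  generalize k * L = B at *
  omega

/-- **A row is an arithmetic progression**: for `j < k`, the row `{x ∈ ℤ/L : ⌊x.val·k/L⌋ = j}` is the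
image of `range (a_{j+1} − a_j)` under `m ↦ a_j + m` (`a_j = ⌈jL/k⌉`). [folklore] -/
theorem rigc_row_eq_image (L : ℕ) [NeZero L] {k j : ℕ} (hk : 0 < k) (hj : j < k) :
    Finset.univ.filter (fun x : ZMod L => x.val * k / L = j) =
      (Finset.range ((((j + 1) * L + k - 1) / k) - ((j * L + k - 1) / k))).image
        (fun m : ℕ => (((j * L + k - 1) / k + m : ℕ) : ZMod L)) := by
  classical
  have hL : 0 < L := Nat.pos_of_ne_zero (NeZero.ne L)
  have htop := rigc_ceil_succ_le (L := L) hk hj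
  ext x
  simp only [Finset.mem_filter, Finset.mem_univ, true_and, Finset.mem_image, Finset.mem_range]
  rw [rigc_mem_row_iff hL hk]
  constructor
  · rintro ⟨h1, h2⟩
    refine ⟨x.val - (j * L + k - 1) / k, by omega, ?_⟩
    rw [Nat.add_sub_cancel' h1, ZMod.natCast_zmod_val]
  · rintro ⟨m, hm, rfl⟩
    have hlt : (j * L + k - 1) / k + m < L := by omega
    rw [ZMod.val_natCast, Nat.mod_eq_of_lt hlt]
    omega

/-- The progression map of a row is injective on its range (all values are `< L`). [folklore] -/
theorem rigc_row_map_injOn (L : ℕ) [NeZero L] {k j : ℕ} (hk : 0 < k) (hj : j < k) :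
    Set.InjOn (fun m : ℕ => (((j * L + k - 1) / k + m : ℕ) : ZMod L))
      (Finset.range ((((j + 1) * L + k - 1) / k) - ((j * L + k - 1) / k)) : Set ℕ) := by
  have htop := rigc_ceil_succ_le (L := L) hk hj
  intro m hm m' hm' h
  simp only [Finset.coe_range, Set.mem_Iio] at hm hm'
  have h1 := congrArg ZMod.val h
  simp only at h1
  rw [ZMod.val_natCast, ZMod.val_natCast, Nat.mod_eq_of_lt (by omega), Nat.mod_eq_of_lt (by omega)] at h1
  omega

/-- **Row size**: `|R_j| = a_{j+1} − a_j` and `L − k < k |R_j| < L + k`, i.e. `|R_j|` is within `1`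
of `L/k`. [folklore] -/
theorem rigc_row_card_bounds (L : ℕ) [NeZero L] {k j : ℕ} (hk : 0 < k) (hj : j < k) :
    (L : ℝ) / k - 1 < ((Finset.univ.filter (fun x : ZMod L => x.val * k / L = j)).card : ℝ) ∧
      ((Finset.univ.filter (fun x : ZMod L => x.val * k / L = j)).card : ℝ) < (L : ℝ) / k + 1 := by
  classical
  rw [rigc_row_eq_image L hk hj, Finset.card_image_of_injOn (rigc_row_map_injOn L hk hj), Finset.card_range]
  have h1 := rigc_mul_ceilDiv_bounds hk (j * L)
  have h2 := rigc_mul_ceilDiv_bounds hk ((j + 1) * L)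
  have hkr : (0 : ℝ) < k := by exact_mod_cast hk
  set a := (j * L + k - 1) / k with ha
  set a' := ((j + 1) * L + k - 1) / k with ha'
  have hle : a ≤ a' :=
    Nat.div_le_div_right (Nat.sub_le_sub_right (Nat.add_le_add_right (Nat.mul_le_mul_right L (Nat.le_succ j)) k) 1)
  have hk1 : 1 ≤ k := hk
  -- `k (a' − a)` is within `k − 1` of `L`
  have h3 : ((a' - a : ℕ) : ℝ) * k = (a' : ℝ) * k - (a : ℝ) * k := by
    rw [Nat.cast_sub hle]; ring
  have h1l : (j * L : ℝ) ≤ (a : ℝ) * k := by exact_mod_cast h1.1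
  have h1u : (a : ℝ) * k ≤ j * L + k - 1 := by
    have hsub : 1 ≤ j * L + k := le_add_left hk1
    have h' : ((a * k : ℕ) : ℝ) ≤ ((j * L + k - 1 : ℕ) : ℝ) := by exact_mod_cast h1.2
    rw [Nat.cast_sub hsub] at h'
    push_cast at h'
    linarith
  have h2l : ((j + 1) * L : ℝ) ≤ (a' : ℝ) * k := by exact_mod_cast h2.1
  have h2u : (a' : ℝ) * k ≤ (j + 1) * L + k - 1 := by
    have hsub : 1 ≤ (j + 1) * L + k := le_add_left hk1
    have h' : ((a' * k : ℕ) : ℝ) ≤ (((j + 1) * L + k - 1 : ℕ) : ℝ) := by exact_mod_cast h2.2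
    rw [Nat.cast_sub hsub] at h'
    push_cast at h'
    linarith
  constructor
  · rw [div_sub_one hkr.ne', div_lt_iff₀ hkr, h3]
    linarith
  · rw [div_add_one hkr.ne', lt_div_iff₀ hkr, h3]
    linarith

/-! ### Cells as products of rows -/

/-- **A cell is the product of its two rows**: `{x : cellOf L k x = b} = Π_i R_{(b i).val}`. [folklore] -/
theorem rigc_cell_eq_piFinset (L : ℕ) [NeZero L] (k : ℕ) [NeZero k] (b : TorusSite 2 k) :
    Finset.univ.filter (fun x : TorusSite 2 L => cellOf L k x = b) =
      Fintype.piFinset (fun i : Fin 2 => Finset.univ.filter (fun x : ZMod L => x.val * k / L = (b i).val)) := by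
  ext x
  simp only [Finset.mem_filter, Finset.mem_univ, true_and, Fintype.mem_piFinset]
  constructor
  · intro h i
    rw [← rig_cellIndex_val (k := k) (x i)]
    exact congrArg ZMod.val (congrFun h i)
  · intro h
    funext i
    apply ZMod.val_injective k
    show (cellIndex L k (x i)).val = (b i).val
    rw [rig_cellIndex_val]
    exact h i

/-- **Product formula for the cell transform**: `Σ_{x ∈ cell b} χ_q(x) = Π_i Σ_{x_i ∈ R_{b i}} e((q i) x_i)`. [folklore] -/
theorem rigc_cellTransform_eq_prod (L : ℕ) [NeZero L] (k : ℕ) [NeZero k] (b : TorusSite 2 k) (q : TorusSite 2 L) :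
    ∑ x ∈ Finset.univ.filter (fun x : TorusSite 2 L => cellOf L k x = b), torusChar q x =
      ∏ i : Fin 2, ∑ t ∈ Finset.univ.filter (fun x : ZMod L => x.val * k / L = (b i).val),
        (ZMod.stdAddChar (q i * t) : ℂ) := by
  rw [rigc_cell_eq_piFinset, Finset.prod_univ_sum]
  rfl

/-- The cell size is the product of the two row sizes. [folklore] -/
theorem rigc_cell_card (L : ℕ) [NeZero L] (k : ℕ) [NeZero k] (b : TorusSite 2 k) :
    (Finset.univ.filter (fun x : TorusSite 2 L => cellOf L k x = b)).card =
      ∏ i : Fin 2, (Finset.univ.filter (fun x : ZMod L => x.val * k / L = (b i).val)).card := by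
  rw [rigc_cell_eq_piFinset, Fintype.card_piFinset]

/-- `‖ĝ_b(q)‖ ≤ |cell b|` (each character value has norm one). [folklore] -/
theorem rigc_norm_cellTransform_le (L : ℕ) [NeZero L] (k : ℕ) [NeZero k] (b : TorusSite 2 k) (q : TorusSite 2 L) :
    ‖∑ x ∈ Finset.univ.filter (fun x : TorusSite 2 L => cellOf L k x = b), torusChar q x‖ ≤
      ((Finset.univ.filter (fun x : TorusSite 2 L => cellOf L k x = b)).card : ℝ) := by
  refine (norm_sum_le _ _).trans (le_of_eq ?_)
  simp only [norm_torusChar, Finset.sum_const, nsmul_eq_mul, mul_one]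

/-- The transform at `q = 0` is the cell size. [folklore] -/
theorem rigc_cellTransform_zero (L : ℕ) [NeZero L] (k : ℕ) [NeZero k] (b : TorusSite 2 k) :
    ∑ x ∈ Finset.univ.filter (fun x : TorusSite 2 L => cellOf L k x = b), torusChar (0 : TorusSite 2 L) x =
      ((Finset.univ.filter (fun x : TorusSite 2 L => cellOf L k x = b)).card : ℂ) := by
  have h0 : ∀ x : TorusSite 2 L, torusChar (0 : TorusSite 2 L) x = 1 := fun x => by
    rw [torusChar_comm]; simp [torusChar]
  simp only [h0, Finset.sum_const, nsmul_eq_mul, mul_one]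

/-! ### Row transforms: Dirichlet bound and Parseval -/

/-- **Row Dirichlet bound**: for `q ≠ 0`, `‖Σ_{x ∈ R_j} e(q x)‖ ≤ L/(2‖q‖)`. [folklore] -/
theorem rigc_norm_rowTransform_le (L : ℕ) [NeZero L] {k j : ℕ} (hk : 0 < k) (hj : j < k) {q : ZMod L} (hq : q ≠ 0) :
    ‖∑ t ∈ Finset.univ.filter (fun x : ZMod L => x.val * k / L = j), (ZMod.stdAddChar (q * t) : ℂ)‖ ≤
      (L : ℝ) / (2 * ((min q.val (L - q.val) : ℕ) : ℝ)) := by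
  classical
  rw [rigc_row_eq_image L hk hj, Finset.sum_image (rigc_row_map_injOn L hk hj)]
  exact rigc_norm_charSum_progression_le L hq _ _

/-- **Row Parseval**: `Σ_q ‖Σ_{x ∈ R_j} e(q x)‖² = L |R_j|`. [folklore] -/
theorem rigc_sum_normSq_rowTransform (L : ℕ) [NeZero L] (k j : ℕ) :
    ∑ q : ZMod L, ‖∑ t ∈ Finset.univ.filter (fun x : ZMod L => x.val * k / L = j), (ZMod.stdAddChar (q * t) : ℂ)‖ ^ 2 =
      (L : ℝ) * (Finset.univ.filter (fun x : ZMod L => x.val * k / L = j)).card :=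
  rigc_sum_normSq_charSum L _

/-- The one-dimensional tail of a row transform: `Σ_{q : ‖q‖ > K} ‖r_j(q)‖² ≤ L²/(2K)` (`K ≥ 1`). [folklore] -/
theorem rigc_rowTransform_tail_le (L : ℕ) [NeZero L] {k j K : ℕ} (hk : 0 < k) (hj : j < k) (hK : 1 ≤ K) :
    ∑ q ∈ Finset.univ.filter (fun q : ZMod L => K < min q.val (L - q.val)),
        ‖∑ t ∈ Finset.univ.filter (fun x : ZMod L => x.val * k / L = j), (ZMod.stdAddChar (q * t) : ℂ)‖ ^ 2 ≤
      (L : ℝ) ^ 2 / (2 * K) := by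
  have hL : (0 : ℝ) < L := Nat.cast_pos.mpr (Nat.pos_of_ne_zero (NeZero.ne L))
  have hpt : ∀ q ∈ Finset.univ.filter (fun q : ZMod L => K < min q.val (L - q.val)),
      ‖∑ t ∈ Finset.univ.filter (fun x : ZMod L => x.val * k / L = j), (ZMod.stdAddChar (q * t) : ℂ)‖ ^ 2 ≤
        (L : ℝ) ^ 2 / 4 * ((1 : ℝ) / (((min q.val (L - q.val) : ℕ) : ℝ)) ^ 2) := by
    intro q hq
    rw [Finset.mem_filter] at hq
    have hq0 : q ≠ 0 := by
      intro h0; rw [h0, ZMod.val_zero] at hq; simp at hq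
    have hm : (0 : ℝ) < ((min q.val (L - q.val) : ℕ) : ℝ) := by exact_mod_cast (by omega : 0 < min q.val (L - q.val))
    have h1 := rigc_norm_rowTransform_le L hk hj hq0
    have h2 := pow_le_pow_left₀ (norm_nonneg _) h1 2
    refine h2.trans (le_of_eq ?_)
    field_simp
    ring
  refine (Finset.sum_le_sum hpt).trans ?_
  rw [← Finset.mul_sum]
  have h3 := rigc_sum_inv_normSq_tail_le L hK
  have hKr : (0 : ℝ) < K := by exact_mod_cast hK
  calc (L : ℝ) ^ 2 / 4 * ∑ q ∈ Finset.univ.filter (fun q : ZMod L => K < min q.val (L - q.val)),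
        (1 : ℝ) / (((min q.val (L - q.val) : ℕ) : ℝ)) ^ 2
      ≤ (L : ℝ) ^ 2 / 4 * (2 / K) := mul_le_mul_of_nonneg_left h3 (by positivity)
    _ = (L : ℝ) ^ 2 / (2 * K) := by field_simp; ring

/-! ### The two-dimensional tail estimate -/

/-- Splitting a sum over `(ℤ/L)²` of a product of one-coordinate factors. [folklore] -/
theorem rigc_sum_prod_two (L : ℕ) [NeZero L] (F G : ZMod L → ℝ) :
    ∑ q : TorusSite 2 L, F (q 0) * G (q 1) = (∑ a : ZMod L, F a) * ∑ c : ZMod L, G c := by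
  have h := Finset.prod_univ_sum (fun _ : Fin 2 => (Finset.univ : Finset (ZMod L)))
    (fun i t => if i = 0 then F t else G t)
  rw [Fin.prod_univ_two] at h
  simp only [Fin.isValue, ↓reduceIte, one_ne_zero, Fintype.piFinset_univ] at h
  rw [h]
  refine Finset.sum_congr rfl fun q _ => ?_
  rw [Fin.prod_univ_two]
  simp

/-- **Tail estimate for the cell transform, first coordinate**: for `K ≥ 1`,
`Σ_{q : ‖q 0‖ > K} ‖ĝ_b(q)‖² ≤ L²/(2K) · L (L/k + 1)`. [folklore] -/
theorem rigc_cellTransform_tail_le_zero (L : ℕ) [NeZero L] (k : ℕ) [NeZero k] (b : TorusSite 2 k) {K : ℕ} (hK : 1 ≤ K) :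
    ∑ q ∈ Finset.univ.filter (fun q : TorusSite 2 L => K < min (q 0).val (L - (q 0).val)),
        ‖∑ x ∈ Finset.univ.filter (fun x : TorusSite 2 L => cellOf L k x = b), torusChar q x‖ ^ 2 ≤
      (L : ℝ) ^ 2 / (2 * K) * ((L : ℝ) * ((L : ℝ) / k + 1)) := by
  classical
  have hk : 0 < k := Nat.pos_of_ne_zero (NeZero.ne k)
  have hL : (0 : ℝ) < L := Nat.cast_pos.mpr (Nat.pos_of_ne_zero (NeZero.ne L))
  set r : Fin 2 → ZMod L → ℂ := fun i a =>
    ∑ t ∈ Finset.univ.filter (fun x : ZMod L => x.val * k / L = (b i).val), (ZMod.stdAddChar (a * t) : ℂ) with hr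
  have hprod : ∀ q : TorusSite 2 L,
      ‖∑ x ∈ Finset.univ.filter (fun x : TorusSite 2 L => cellOf L k x = b), torusChar q x‖ ^ 2 =
        ‖r 0 (q 0)‖ ^ 2 * ‖r 1 (q 1)‖ ^ 2 := by
    intro q
    rw [rigc_cellTransform_eq_prod, Fin.prod_univ_two, norm_mul, mul_pow]
  have htail : ∑ a ∈ Finset.univ.filter (fun a : ZMod L => K < min a.val (L - a.val)), ‖r 0 a‖ ^ 2 ≤
      (L : ℝ) ^ 2 / (2 * K) := rigc_rowTransform_tail_le L hk (ZMod.val_lt (b 0)) hK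
  have hpars : ∑ a : ZMod L, ‖r 1 a‖ ^ 2 ≤ (L : ℝ) * ((L : ℝ) / k + 1) := by
    rw [hr]
    simp only
    rw [rigc_sum_normSq_rowTransform]
    exact mul_le_mul_of_nonneg_left (rigc_row_card_bounds L hk (ZMod.val_lt (b 1))).2.le hL.le
  rw [Finset.sum_filter]
  have hsplit : ∑ q : TorusSite 2 L, (if K < min (q 0).val (L - (q 0).val) then
      ‖∑ x ∈ Finset.univ.filter (fun x : TorusSite 2 L => cellOf L k x = b), torusChar q x‖ ^ 2 else 0) =
      (∑ a : ZMod L, if K < min a.val (L - a.val) then ‖r 0 a‖ ^ 2 else 0) * ∑ c : ZMod L, ‖r 1 c‖ ^ 2 := by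
    rw [← rigc_sum_prod_two L (fun a => if K < min a.val (L - a.val) then ‖r 0 a‖ ^ 2 else 0) (fun c => ‖r 1 c‖ ^ 2)]
    refine Finset.sum_congr rfl fun q _ => ?_
    rw [hprod q]
    split_ifs <;> simp
  rw [hsplit, ← Finset.sum_filter]
  exact mul_le_mul htail hpars (Finset.sum_nonneg fun _ _ => by positivity) (by positivity)

/-- **Tail estimate for the cell transform, second coordinate**: for `K ≥ 1`,
`Σ_{q : ‖q 1‖ > K} ‖ĝ_b(q)‖² ≤ L²/(2K) · L (L/k + 1)`. [folklore] -/
theorem rigc_cellTransform_tail_le_one (L : ℕ) [NeZero L] (k : ℕ) [NeZero k] (b : TorusSite 2 k) {K : ℕ} (hK : 1 ≤ K) :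
    ∑ q ∈ Finset.univ.filter (fun q : TorusSite 2 L => K < min (q 1).val (L - (q 1).val)),
        ‖∑ x ∈ Finset.univ.filter (fun x : TorusSite 2 L => cellOf L k x = b), torusChar q x‖ ^ 2 ≤
      (L : ℝ) ^ 2 / (2 * K) * ((L : ℝ) * ((L : ℝ) / k + 1)) := by
  classical
  have hk : 0 < k := Nat.pos_of_ne_zero (NeZero.ne k)
  have hL : (0 : ℝ) < L := Nat.cast_pos.mpr (Nat.pos_of_ne_zero (NeZero.ne L))
  set r : Fin 2 → ZMod L → ℂ := fun i a =>
    ∑ t ∈ Finset.univ.filter (fun x : ZMod L => x.val * k / L = (b i).val), (ZMod.stdAddChar (a * t) : ℂ) with hr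
  have hprod : ∀ q : TorusSite 2 L,
      ‖∑ x ∈ Finset.univ.filter (fun x : TorusSite 2 L => cellOf L k x = b), torusChar q x‖ ^ 2 =
        ‖r 0 (q 0)‖ ^ 2 * ‖r 1 (q 1)‖ ^ 2 := by
    intro q
    rw [rigc_cellTransform_eq_prod, Fin.prod_univ_two, norm_mul, mul_pow]
  have htail : ∑ a ∈ Finset.univ.filter (fun a : ZMod L => K < min a.val (L - a.val)), ‖r 1 a‖ ^ 2 ≤
      (L : ℝ) ^ 2 / (2 * K) := rigc_rowTransform_tail_le L hk (ZMod.val_lt (b 1)) hK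
  have hpars : ∑ a : ZMod L, ‖r 0 a‖ ^ 2 ≤ (L : ℝ) * ((L : ℝ) / k + 1) := by
    rw [hr]
    simp only
    rw [rigc_sum_normSq_rowTransform]
    exact mul_le_mul_of_nonneg_left (rigc_row_card_bounds L hk (ZMod.val_lt (b 0))).2.le hL.le
  rw [Finset.sum_filter]
  have hsplit : ∑ q : TorusSite 2 L, (if K < min (q 1).val (L - (q 1).val) then
      ‖∑ x ∈ Finset.univ.filter (fun x : TorusSite 2 L => cellOf L k x = b), torusChar q x‖ ^ 2 else 0) =
      (∑ a : ZMod L, ‖r 0 a‖ ^ 2) * ∑ c : ZMod L, (if K < min c.val (L - c.val) then ‖r 1 c‖ ^ 2 else 0) := by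
    rw [← rigc_sum_prod_two L (fun a => ‖r 0 a‖ ^ 2) (fun c => if K < min c.val (L - c.val) then ‖r 1 c‖ ^ 2 else 0)]
    refine Finset.sum_congr rfl fun q _ => ?_
    rw [hprod q]
    split_ifs <;> simp
  rw [hsplit, ← Finset.sum_filter, mul_comm]
  exact mul_le_mul htail hpars (Finset.sum_nonneg fun _ _ => by positivity) (by positivity)

/-- **Tail estimate for the cell transform, registered form** (all binders after the colon): the
statement of `rigc_cellTransform_tail_le_zero`. [folklore] -/
theorem rigc_cell_tail_zero : ∀ (L : ℕ) [NeZero L] (k : ℕ) [NeZero k] (b : TorusSite 2 k) (K : ℕ), 1 ≤ K → ∑ q ∈ Finset.univ.filter (fun q : TorusSite 2 L => K < min (q 0).val (L - (q 0).val)), ‖∑ x ∈ Finset.univ.filter (fun x : TorusSite 2 L => cellOf L k x = b), torusChar q x‖ ^ 2 ≤ (L : ℝ) ^ 2 / (2 * K) * ((L : ℝ) * ((L : ℝ) / k + 1)) :=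
  fun L _ k _ b _ hK => rigc_cellTransform_tail_le_zero L k b hK

end Summit.HubbardSuperconductivity.HubbardSuperconductivity.Theorems.LowEnergyRigidity.Telescope
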